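/- Free-seat work of EXTRA WIDTH SEAT `ym-line-cbag-p1-w4` (prover-ym-line-cbag-p1-w4-g2-0), route `EguchiKawaiDirectionLadder`
(ideator ym-idea-2, LINE 8), crux `TripleSmallBallMargin` (stmt-QuantumFields-27724): the CAPSTONE of stub S9 «Abs» of the LEAD's v7
architecture (ARCH-27724-lead-g24.md §3(ii)–(iii)): the one-level decoupling inequality with the block-local robust pair events already
transported to Haar pairs of the block sizes — the consumer (S10) supplies only the off-block events `A₁, A₂`, the far-mass bounds on
them, and a rank-robust pair small-ball bound (Ψ_rob) per decoupled block.  ROUTE-INDEPENDENT.  Nothing here bears on the Yang–Mills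
mass gap. -/
import Summits.QuantumFields.YangMills.Theorems.EguchiKawaiDirectionLadderBlockPairLaw
import Summits.QuantumFields.YangMills.Theorems.EguchiKawaiDirectionLadderBlockPairCross
import Summits.QuantumFields.YangMills.Theorems.EguchiKawaiDirectionLadderBlockFibreBound
import HarnessLib

/-!
# Route `EguchiKawaiDirectionLadder`: one decoupling level (S9 capstone)

`haar_prod_le_prod_robustPair_mul` — for a labelling `ℓ : Fin N → Fin m`, a set `T` of blocks to decouple, a set `near` of collar labels,
a measurable pair event `E ⊆ U(N) × U(N)` and sets `A₁, A₂ ⊆ U(N)`: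
if (h_off) `(X·ι(D), Y·ι(D′)) ∈ E` (block unitaries `D, D′` equal to `1` off `T`) forces `X ∈ A₁, Y ∈ A₂`;
(h_block) on `E` every diagonal block `c ∈ T` of the commutator has Frobenius² `≤ s`;
(h_far) for `X ∈ A₁, Y ∈ A₂` the far cross masses are `≤ Φ` and the far compression masses `≤ Φ₁` (`Φ₁ > 0`);
(h_Ψ) for every `c ∈ T` the Haar-pair measure of the rank-robust pair event of block size `#{ℓ=c}` with rank slack `6·Σ_{a∈near}#{ℓ=a}` and
Frobenius² slack `σ = 2(2s + 2Φ) + 24(2Φ₁ + 2Φ₁ + 2Φ₁·2Φ₁)` is `≤ p c`;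
then `Haar²(E) ≤ (∏_{c∈T} p c) · Haar²(A₁ ×ˢ A₂)`.

Assembly of: `haar_prod_le_prod_mul_of_blockPair_fibres` (…BlockPairLaw), `blockLocal_robustPair_of_commutatorBlock_small` (…BlockPairCross),
`compression_split_labels` + `blockFibre_le_transfer` (…BlockFibreBound).

HONEST FRAMING: bookkeeping; the small-ball inputs (Ψ_rob) and the off-block bound `Haar²(A₁ ×ˢ A₂)` are hypotheses.  The route bears
on the barrier-ledger fact `EguchiKawaiBreakdown` only.
-/

set_option autoImplicit false

noncomputable section

open MeasureTheory
open scoped Matrix ENNReal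
open Literature.Barriers.QuantumFields

namespace Summit.QuantumFields.YangMills.Theorems.EguchiKawaiDirectionLadder

variable {N m : ℕ}

/-- **ONE DECOUPLING LEVEL (S9).**  See the module docstring. -/
theorem haar_prod_le_prod_robustPair_mul (ℓ : Fin N → Fin m) (T near : Finset (Fin m)) {E : Set (UN N × UN N)}
    (hE : MeasurableSet E) (A₁ A₂ : Set (UN N)) {s Φ Φ₁ : ℝ} (hΦ₁ : 0 < Φ₁) (p : Fin m → ℝ≥0∞)
    (h_off : ∀ (X Y : UN N) (W : BlockUnitaryPairs ℓ),
      (X * blockDiagUnitary ℓ (fstOn T W), Y * blockDiagUnitary ℓ (sndOn T W)) ∈ E → X ∈ A₁ ∧ Y ∈ A₂)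
    (h_block : ∀ (X Y : UN N) (W : BlockUnitaryPairs ℓ),
      (X * blockDiagUnitary ℓ (fstOn T W), Y * blockDiagUnitary ℓ (sndOn T W)) ∈ E → ∀ c ∈ T,
        ∑ i, ∑ j, ‖((X : Matrix (Fin N) (Fin N) ℂ) *
              blockDiag ℓ (fun a => (fstOn T W a : Matrix {i : Fin N // ℓ i = a} {i : Fin N // ℓ i = a} ℂ)) *
            ((Y : Matrix (Fin N) (Fin N) ℂ) *
              blockDiag ℓ (fun a => (sndOn T W a : Matrix {i : Fin N // ℓ i = a} {i : Fin N // ℓ i = a} ℂ))) -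
          (Y : Matrix (Fin N) (Fin N) ℂ) *
              blockDiag ℓ (fun a => (sndOn T W a : Matrix {i : Fin N // ℓ i = a} {i : Fin N // ℓ i = a} ℂ)) *
            ((X : Matrix (Fin N) (Fin N) ℂ) *
              blockDiag ℓ (fun a => (fstOn T W a : Matrix {i : Fin N // ℓ i = a} {i : Fin N // ℓ i = a} ℂ)))).toBlock
            (fun i => ℓ i = c) (fun i => ℓ i = c) i j‖ ^ 2 ≤ s)
    (h_far : ∀ X ∈ A₁, ∀ Y ∈ A₂, ∀ c ∈ T,
      2 * ((Finset.univ.erase c).filter (fun a => a ∉ near)).card *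
        ∑ a ∈ (Finset.univ.erase c).filter (fun a => a ∉ near),
          farPairMass ℓ (X : Matrix (Fin N) (Fin N) ℂ) (Y : Matrix (Fin N) (Fin N) ℂ) c a ≤ Φ)
    (h_far₁ : ∀ X ∈ A₁ ∪ A₂, ∀ c ∈ T,
      6 * (((Finset.univ.erase c).filter (fun a => a ∉ near)).card *
        ∑ a ∈ (Finset.univ.erase c).filter (fun a => a ∉ near),
          (∑ i, ∑ j, ‖(X : Matrix (Fin N) (Fin N) ℂ).toBlock (fun i => ℓ i = c) (fun i => ℓ i = a) i j‖ ^ 2) ^ 2) ≤ Φ₁)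
    (h_Ψ : ∀ c ∈ T,
      (Literature.MathematicalPhysics.QuantumFieldTheory.haarProbability (Matrix.unitaryGroup {i : Fin N // ℓ i = c} ℂ)).prod
        (Literature.MathematicalPhysics.QuantumFieldTheory.haarProbability (Matrix.unitaryGroup {i : Fin N // ℓ i = c} ℂ))
        {P | ∃ L : Matrix {i : Fin N // ℓ i = c} {i : Fin N // ℓ i = c} ℂ,
          L.rank ≤ 2 * ∑ a ∈ near, Fintype.card {i : Fin N // ℓ i = a} +
            2 * (∑ a ∈ near, Fintype.card {i : Fin N // ℓ i = a} + ∑ a ∈ near, Fintype.card {i : Fin N // ℓ i = a}) ∧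
          ∑ i, ∑ j, ‖((P.1 : Matrix {i : Fin N // ℓ i = c} {i : Fin N // ℓ i = c} ℂ) * (P.2 : Matrix {i : Fin N // ℓ i = c} {i : Fin N // ℓ i = c} ℂ) - (P.2 : Matrix {i : Fin N // ℓ i = c} {i : Fin N // ℓ i = c} ℂ) * (P.1 : Matrix {i : Fin N // ℓ i = c} {i : Fin N // ℓ i = c} ℂ) - L) i j‖ ^ 2 ≤
            2 * (2 * s + 2 * Φ) + 24 * (2 * Φ₁ + 2 * Φ₁ + 2 * Φ₁ * (2 * Φ₁))} ≤ p c) :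
    (Literature.MathematicalPhysics.QuantumFieldTheory.haarProbability (UN N)).prod
        (Literature.MathematicalPhysics.QuantumFieldTheory.haarProbability (UN N)) E ≤
      (∏ c ∈ T, p c) *
        (Literature.MathematicalPhysics.QuantumFieldTheory.haarProbability (UN N)).prod
          (Literature.MathematicalPhysics.QuantumFieldTheory.haarProbability (UN N)) (A₁ ×ˢ A₂) := by
  classical
  refine haar_prod_le_prod_mul_of_blockPair_fibres ℓ T hE A₁ A₂
    (fun c X Y => {V | ∃ J : Matrix {i : Fin N // ℓ i = c} {i : Fin N // ℓ i = c} ℂ,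
      J.rank ≤ 2 * ∑ a ∈ near, Fintype.card {i : Fin N // ℓ i = a} ∧
      ∑ i, ∑ j, ‖((X : Matrix (Fin N) (Fin N) ℂ).toBlock (fun i => ℓ i = c) (fun i => ℓ i = c) *
            (V.1 : Matrix {i : Fin N // ℓ i = c} {i : Fin N // ℓ i = c} ℂ) *
          ((Y : Matrix (Fin N) (Fin N) ℂ).toBlock (fun i => ℓ i = c) (fun i => ℓ i = c) *
            (V.2 : Matrix {i : Fin N // ℓ i = c} {i : Fin N // ℓ i = c} ℂ)) -
          (Y : Matrix (Fin N) (Fin N) ℂ).toBlock (fun i => ℓ i = c) (fun i => ℓ i = c) *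
            (V.2 : Matrix {i : Fin N // ℓ i = c} {i : Fin N // ℓ i = c} ℂ) *
          ((X : Matrix (Fin N) (Fin N) ℂ).toBlock (fun i => ℓ i = c) (fun i => ℓ i = c) *
            (V.1 : Matrix {i : Fin N // ℓ i = c} {i : Fin N // ℓ i = c} ℂ)) - J) i j‖ ^ 2 ≤ 2 * s + 2 * Φ}) p ?_ ?_
  · -- h1: off-block membership and the block-local event
    intro X Y W hW
    obtain ⟨hX, hY⟩ := h_off X Y W hW
    refine ⟨hX, hY, fun c hc => ?_⟩
    have hs := h_block X Y W hW c hc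
    obtain ⟨J', hJ', hJ's⟩ := blockLocal_robustPair_of_commutatorBlock_small ℓ (X : Matrix (Fin N) (Fin N) ℂ)
      (Y : Matrix (Fin N) (Fin N) ℂ) (fstOn T W) (sndOn T W) c near hs
    have hfarXY := h_far X hX Y hY c hc
    refine ⟨J', hJ', ?_⟩
    have hwp : withinPair ℓ (X : Matrix (Fin N) (Fin N) ℂ) (Y : Matrix (Fin N) (Fin N) ℂ) (fstOn T W) (sndOn T W) c =
        (X : Matrix (Fin N) (Fin N) ℂ).toBlock (fun i => ℓ i = c) (fun i => ℓ i = c) *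
            ((W c).1 : Matrix {i : Fin N // ℓ i = c} {i : Fin N // ℓ i = c} ℂ) *
          ((Y : Matrix (Fin N) (Fin N) ℂ).toBlock (fun i => ℓ i = c) (fun i => ℓ i = c) *
            ((W c).2 : Matrix {i : Fin N // ℓ i = c} {i : Fin N // ℓ i = c} ℂ)) -
          (Y : Matrix (Fin N) (Fin N) ℂ).toBlock (fun i => ℓ i = c) (fun i => ℓ i = c) *
            ((W c).2 : Matrix {i : Fin N // ℓ i = c} {i : Fin N // ℓ i = c} ℂ) *
          ((X : Matrix (Fin N) (Fin N) ℂ).toBlock (fun i => ℓ i = c) (fun i => ℓ i = c) *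
            ((W c).1 : Matrix {i : Fin N // ℓ i = c} {i : Fin N // ℓ i = c} ℂ)) := by
      unfold withinPair crossTerm
      rw [fstOn_of_mem W hc, sndOn_of_mem W hc]
    rw [hwp] at hJ's
    linarith
  · -- h2: the block fibre bound
    intro X hX Y hY c hc
    have hX₁ : X ∈ A₁ ∪ A₂ := Set.mem_union_left _ hX
    have hY₁ : Y ∈ A₁ ∪ A₂ := Set.mem_union_right _ hY
    obtain ⟨Θ₁, R₁, S₁, hΘ₁, hR₁, hS₁, hXc⟩ := compression_split_labels ℓ X c near hΦ₁
    obtain ⟨Θ₂, R₂, S₂, hΘ₂, hR₂, hS₂, hYc⟩ := compression_split_labels ℓ Y c near hΦ₁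
    have hS₁' : ∑ i, ∑ j, ‖S₁ i j‖ ^ 2 ≤ 2 * Φ₁ := by have := h_far₁ X hX₁ c hc; linarith
    have hS₂' : ∑ i, ∑ j, ‖S₂ i j‖ ^ 2 ≤ 2 * Φ₁ := by have := h_far₁ Y hY₁ c hc; linarith
    have htr := blockFibre_le_transfer (k := 2 * ∑ a ∈ near, Fintype.card {i : Fin N // ℓ i = a}) (s := 2 * s + 2 * Φ)
      ((X : Matrix (Fin N) (Fin N) ℂ).toBlock (fun i => ℓ i = c) (fun i => ℓ i = c))
      ((Y : Matrix (Fin N) (Fin N) ℂ).toBlock (fun i => ℓ i = c) (fun i => ℓ i = c))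
      ⟨Θ₁, hΘ₁⟩ ⟨Θ₂, hΘ₂⟩ R₁ S₁ R₂ S₂ hXc hYc hR₁ hR₂ hS₁' hS₂'
    exact htr.trans (h_Ψ c hc)

end Summit.QuantumFields.YangMills.Theorems.EguchiKawaiDirectionLadder

end
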